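import Summits.HodgeConjecture.HodgeConjecture.Theorems.F0P3bXiStablyInvariant
import Summits.HodgeConjecture.HodgeConjecture.Theorems.R90S4SimilConjEquivalence
import Literature.NumberTheory.Automorphic.IrreducibleClassesBoxCharRigidity
import Literature.NumberTheory.Automorphic.HeckeEigencharacterPackage
import Literature.NumberTheory.Automorphic.SmoothCharacterOfCharacter
import HarnessLib

/-!
# R90 · S3 · hand p05 (RE-SCOPED, RULING S3-R3) — TYPE HOMOGENEITY of Rogawski `H_v`-packets, §T1: a packet with a one-dimensional member IS that member

R90-TF SLAB (brief v2 1f40d54518340a35), section S3, dealer R90-C12-plan (g0): DEAL `R90/S3/DEAL-S3-WAVE1.R90-C12-plan-g0.md` hand p05 as RE-SCOPED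
by RULING S3-R3 «COMPLEMENT TYPING» (R90 bus 2026-09-04T15:50:18Z) and the dealer's word 15:56:37Z «ORBIT HOMOGENEITY + EXHAUSTION-BY-LOGIC»:
«prove the homogeneity lemmas the complement typing needs so that no mixed junk packet reaches p04's T5 hand — `isOneDimH_of_mem_of_exists :
IsRogPacketH L v ρ → (∃ σ ∈ ρ, IsOneDimH L v σ) → ∀ σ ∈ ρ, IsOneDimH L v σ` (similitude-conjugate∕twist of a character is a character) …; type T1's
lemma first».  Seat K2E1-p11 (g3); crux H413 = `stmt-HodgeConjecture-24833`, route `HCCMUnconditional`, lane `--supports … --as helper`.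

THIS EDITION (§T1).  For an `H_v`-packet `ρ = O ⊠ χ₁` in Rogawski's sense (S4-B `R90.S4.IsRogPacketH`: `O` a full similitude-conjugation orbit of an
admissible class of `U(Φ₂)_v`, §11.1 p. 161 «an L-packet on `U(2)` is a `PGL₂(F)`-orbit»; §12.1 p. 171 «`ρ = ρ₁ ⊗ χ`») we prove the SHARP form of
T1-homogeneity: **if some member of `ρ` is one-dimensional then `ρ` is the singleton of that member** (`eq_singleton_of_mem_of_isOneDimH`), whence the
dealer's `isOneDimH_of_mem_of_exists`.  The mathematics: a one-dimensional member `⟦ℂ_Ξ⟧ = c ⊠ χ₁` forces `c = ⟦ℂ_{Ξ|U(Φ₂)}⟧` (★ joint rigidity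
`IrrClass.eq_of_boxChar_eq_mk_ofChar`); the orbit `O` of `c` under the similitudes `Ad(T)` (`ᵗT̄ Φ₂ T = a Φ₂`) is `{c}` because **a character `ξ` of
`U(Φ₂)(L⁺_v)` is fixed by every `Ad(T)`**: `ξ(T g T⁻¹) ξ(g)⁻¹ = ξ(T g T⁻¹ g⁻¹) = 1` since `det (T g T⁻¹ g⁻¹) = 1` and EVERY homomorphism
`U(Φ₂)(L⁺_v) →* A` to a commutative group kills the determinant-one elements (★ `F0P3bXiStablyInvariant.apply_eq_one_of_det_eq_one_antidiagOne`, `N = 2`: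
Dieudonné's `SU = U′` for the isotropic form `Φ₂` at non-split `v`, `GL₂`-abelianisation at split `v`); similitude conjugacy being an equivalence
relation (★ `R90S4SimilConjEquivalence`), every member of `O` is conjugate to `c`, hence equal to it.

NAME-SHAPE (CONVENTIONS §2 «Theorems cannot import Cruxes»; S4 RULING S4-R2′ pattern of record): ★ Literature ∕ Theorems imports ONLY; S4-B's
`IsRogPacketH` ∕ `IsRogPacketU2` ∕ `IsU2SimilConj` ∕ `Φ₂Loc` ∕ `IsOneDimH` (tree `R90_S4_HPacketsU2B.lean` :147–:164, :300) are UNFOLDED BYTE FOR BYTE in the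
statements; a by-import defeq PROBE at HOME (`example … : ρ = {σ} := eq_singleton_of_mem_of_isOneDimH L v ρ hρ hσ h1` against `R90.S4.IsRogPacketH` ∕
`R90.S4.IsOneDimH`) is quoted on the R90 bus.  §T2 (Steinberg, p02's spelling `HLengthTwoLabels`), §T3 (irreducible PS), §T4 (lds) follow as
APPEND-ONLY editions of this file once their spellings are of record.

* §1 `comap_mk_ofChar_eq_self` — generic: `⟦ℂ_ξ⟧ ∘ e = ⟦ℂ_ξ⟧` for an automorphism `e` with `ξ ∘ e = ξ`.
* §2 `char_apply_cmDatumLocalCongr` — `ξ(Ad(T) g) = ξ(g)` for every character `ξ` of `U(Φ₂)(L⁺_v)` and every similitude `T`.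
* §3 `comap_cmDatumLocalCongr_mk_ofChar`, `eq_of_u2SimilConj_mk_ofChar` — the similitude orbit of a character class is trivial.
* §4 (T1) `eq_singleton_of_mem_of_isOneDimH`, `isOneDimH_of_mem_of_exists`.

HONEST LABEL: HC_CM is proved only modulo the 7 printed citations (2 remaining named inputs: hLiu418 = stmt-HodgeConjecture-24832, h413 = stmt-HodgeConjecture-24833)
until rung 0 closes; this file is sorry-free local representation theory (no printed theorem of Ch. 13 is discharged by it); REL ≠ ★ ≠ BUILT.

## References
* [Rogawski1990] J. D. Rogawski, *Automorphic Representations of Unitary Groups in Three Variables*, Ann. of Math. Stud. 123 (1990): §11.1 p. 161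
  (packets of `U(2)` as `PGL₂(F)`-orbits; Prop. 11.1.1), §12.1 pp. 171–172 (`H`-packets `ρ₁ ⊗ χ`), §13.1 Prop. 13.1.4 p. 199 (one-dimensional `ξ`).
* [Dieudonne1971GroupesClassiques] J. Dieudonné, *La géométrie des groupes classiques*, 3e éd. (1971), Chap. II §5 (`SU_n(K,f) ≤ U_n(K,f)′`, index `≥ 1`).
* [BushnellHenniart2006] C. J. Bushnell, G. Henniart, *The Local Langlands Conjecture for GL(2)*, Grundlehren 335 (2006), §1.1, §1.5, §9.1.
* [PlatonovRapinchuk1994] V. Platonov, A. Rapinchuk, *Algebraic Groups and Number Theory* (1994), §2.3 (similitudes).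
-/

set_option autoImplicit false
-- the mandated namespace repeats the single-problem summit's segment (`HodgeConjecture.HodgeConjecture`)
set_option linter.dupNamespace false

noncomputable section

open NumberField IsDedekindDomain
open scoped Matrix MatrixGroups
open Literature.NumberTheory.Automorphic Literature.NumberTheory.Automorphic.UnitaryGroup

namespace Summit.HodgeConjecture.HodgeConjecture.R90.S3

/-! ## §1 Generic: pulling a character class back along an automorphism that fixes the character -/

section Generic

variable {G : Type} [Group G] [TopologicalSpace G] [IsTopologicalGroup G]

/-- **`⟦ℂ_ξ⟧ ∘ e = ⟦ℂ_ξ⟧` when `ξ ∘ e = ξ`**: the identity of `ℂ` intertwines `g ↦ ξ(e g)·` and `g ↦ ξ(g)·`. [cite: BushnellHenniart2006, §1.1, §1.5] -/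
theorem comap_mk_ofChar_eq_self (e : G ≃ₜ* G) (ξ : G →* ℂˣ) (hξ : IsOpen ((ξ.ker : Subgroup G) : Set G))
    (he : ∀ g, ξ (e g) = ξ g) :
    IrrClass.comap e (IrrClass.mk (SmoothIrrep.ofChar ξ hξ)) = IrrClass.mk (SmoothIrrep.ofChar ξ hξ) := by
  rw [IrrClass.comap_mk]
  refine IrrClass.mk_eq_mk_of_equiv (Representation.Equiv.mk (LinearEquiv.refl ℂ _) fun g => ?_)
  refine LinearMap.ext fun z => ?_
  change (SmoothIrrep.ofChar ξ hξ).ρ (e g) z = (SmoothIrrep.ofChar ξ hξ).ρ g z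
  rw [SmoothIrrep.ofChar_ρ_apply, SmoothIrrep.ofChar_ρ_apply, he]

end Generic

/-! ## §2 Characters of `U(Φ₂)(L⁺_v)` are fixed by similitude conjugation -/

section CM

variable (L : Type) [Field L] [NumberField L] [IsCMField L] (v : HeightOneSpectrum (𝓞 ↥(maximalRealSubfield L)))

/-- **`ξ(T g T⁻¹) = ξ(g)`** for every homomorphism `ξ : U(Φ₂)(L⁺_v) →* ℂˣ` and every similitude `T` of `Φ₂` (`ᵗT̄ Φ₂ T = a Φ₂`, `a` a unit; ★
`cmDatumLocalCongr L v T ha h = Ad(T)`): `det (T g T⁻¹ · g⁻¹) = 1`, and every homomorphism of `U(Φ₂)(L⁺_v)` into a commutative group is trivial on the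
elements of determinant one (★ `apply_eq_one_of_det_eq_one_antidiagOne`, `N = 2`). [cite: Dieudonne1971GroupesClassiques, Chap. II §5]
[cite: Rogawski1990, §11.1 p. 161] [cite: PlatonovRapinchuk1994, §2.3] -/
theorem char_apply_cmDatumLocalCongr
    (ξ : (cmDatum L 2 (Matrix.of fun i j : Fin 2 => if i.val + j.val + 1 = 2 then (1 : L) else 0)).Local v →* ℂˣ)
    (T : GL (Fin 2) (LocalRing L v)) {a : LocalRing L v} (ha : IsUnit a)
    (h : formCongr (conjLocal L (IsCMField.complexConj L) v) T
        ((Matrix.of fun i j : Fin 2 => if i.val + j.val + 1 = 2 then (1 : L) else 0).map (algebraMap L (LocalRing L v))) =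
      a • (Matrix.of fun i j : Fin 2 => if i.val + j.val + 1 = 2 then (1 : L) else 0).map (algebraMap L (LocalRing L v)))
    (g : (cmDatum L 2 (Matrix.of fun i j : Fin 2 => if i.val + j.val + 1 = 2 then (1 : L) else 0)).Local v) :
    ξ (cmDatumLocalCongr L v T ha h g) = ξ g := by
  have hdet : Matrix.GeneralLinearGroup.det
      (((cmDatumLocalCongr L v T ha h g * g⁻¹ :
          (cmDatum L 2 (Matrix.of fun i j : Fin 2 => if i.val + j.val + 1 = 2 then (1 : L) else 0)).Local v)).1 :
        GL (Fin 2) (LocalRing L v)) = 1 := by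
    change Matrix.GeneralLinearGroup.det
        (((cmDatumLocalCongr L v T ha h g).1 : GL (Fin 2) (LocalRing L v)) * (g.1 : GL (Fin 2) (LocalRing L v))⁻¹) = 1
    rw [coe_cmDatumLocalCongr_apply]
    simp only [map_mul, map_inv]
    rw [mul_inv_cancel_comm, mul_inv_cancel]
  have h1 := Cruxes.H413.F0P3bXiStablyInvariant.apply_eq_one_of_det_eq_one_antidiagOne L (N := 2) le_rfl v ξ _ hdet
  rwa [map_mul, map_inv, mul_inv_eq_one] at h1

/-! ## §3 The similitude orbit of a character class of `U(Φ₂)(L⁺_v)` is trivial -/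

/-- **`⟦ℂ_ξ⟧ ∘ Ad(T) = ⟦ℂ_ξ⟧`** for every smooth character `ξ` of `U(Φ₂)(L⁺_v)` and every similitude `T` (§1 + §2).
[cite: Rogawski1990, §11.1 p. 161] [cite: BushnellHenniart2006, §1.5] -/
theorem comap_cmDatumLocalCongr_mk_ofChar
    (ξ : (cmDatum L 2 (Matrix.of fun i j : Fin 2 => if i.val + j.val + 1 = 2 then (1 : L) else 0)).Local v →* ℂˣ)
    (hξ : IsOpen ((ξ.ker : Subgroup ((cmDatum L 2 (Matrix.of fun i j : Fin 2 => if i.val + j.val + 1 = 2 then (1 : L) else 0)).Local v)) :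
      Set ((cmDatum L 2 (Matrix.of fun i j : Fin 2 => if i.val + j.val + 1 = 2 then (1 : L) else 0)).Local v)))
    (T : GL (Fin 2) (LocalRing L v)) {a : LocalRing L v} (ha : IsUnit a)
    (h : formCongr (conjLocal L (IsCMField.complexConj L) v) T
        ((Matrix.of fun i j : Fin 2 => if i.val + j.val + 1 = 2 then (1 : L) else 0).map (algebraMap L (LocalRing L v))) =
      a • (Matrix.of fun i j : Fin 2 => if i.val + j.val + 1 = 2 then (1 : L) else 0).map (algebraMap L (LocalRing L v))) :
    IrrClass.comap (cmDatumLocalCongr L v T ha h) (IrrClass.mk (SmoothIrrep.ofChar ξ hξ)) = IrrClass.mk (SmoothIrrep.ofChar ξ hξ) :=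
  comap_mk_ofChar_eq_self (cmDatumLocalCongr L v T ha h) ξ hξ (char_apply_cmDatumLocalCongr L v ξ T ha h)

/-- **The similitude-conjugation orbit of a character class is the class itself**: if `c′ = ⟦ℂ_ξ⟧ ∘ Ad(T)` for a similitude `T` (S4-B's
`IsU2SimilConj L v ⟦ℂ_ξ⟧ c′`, unfolded) then `c′ = ⟦ℂ_ξ⟧`. [cite: Rogawski1990, §11.1 p. 161] -/
theorem eq_of_u2SimilConj_mk_ofChar
    (ξ : (cmDatum L 2 (Matrix.of fun i j : Fin 2 => if i.val + j.val + 1 = 2 then (1 : L) else 0)).Local v →* ℂˣ)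
    (hξ : IsOpen ((ξ.ker : Subgroup ((cmDatum L 2 (Matrix.of fun i j : Fin 2 => if i.val + j.val + 1 = 2 then (1 : L) else 0)).Local v)) :
      Set ((cmDatum L 2 (Matrix.of fun i j : Fin 2 => if i.val + j.val + 1 = 2 then (1 : L) else 0)).Local v)))
    {c' : IrrClass ((cmDatum L 2 (Matrix.of fun i j : Fin 2 => if i.val + j.val + 1 = 2 then (1 : L) else 0)).Local v)}
    (hc' : ∃ (T : GL (Fin 2) (LocalRing L v)) (a : LocalRing L v) (ha : IsUnit a)
      (h : formCongr (conjLocal L (IsCMField.complexConj L) v) T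
          ((Matrix.of fun i j : Fin 2 => if i.val + j.val + 1 = 2 then (1 : L) else 0).map (algebraMap L (LocalRing L v))) =
        a • (Matrix.of fun i j : Fin 2 => if i.val + j.val + 1 = 2 then (1 : L) else 0).map (algebraMap L (LocalRing L v))),
      c' = IrrClass.comap (cmDatumLocalCongr L v T ha h) (IrrClass.mk (SmoothIrrep.ofChar ξ hξ))) :
    c' = IrrClass.mk (SmoothIrrep.ofChar ξ hξ) := by
  obtain ⟨T, a, ha, h, rfl⟩ := hc'
  exact comap_cmDatumLocalCongr_mk_ofChar L v ξ hξ T ha h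

/-! ## §4 (T1) An `H_v`-packet with a one-dimensional member is the singleton of that member -/

/-- **(T1, sharp form) a Rogawski `H_v`-packet containing a one-dimensional class IS that class.**  NAME-SHAPE: `hρ` is S4-B's `IsRogPacketH L v ρ`
(`ρ = O ⊠ χ₁`, `O` the similitude orbit of an admissible class of `U(Φ₂)_v` — `IsRogPacketU2`, `IsU2SimilConj`, `Φ₂Loc` unfolded) and `h1` is S4-B's
`IsOneDimH L v σ`, both UNFOLDED BYTE FOR BYTE.  Proof: `σ = ⟦ℂ_Ξ⟧ = c ⊠ χ₁` gives `c = ⟦ℂ_{Ξ|U(Φ₂)}⟧` (★ `eq_of_boxChar_eq_mk_ofChar`); every `c′ ∈ O`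
is similitude-conjugate to `c` (★ `u2SimilConj_symm`∕`_trans` through the orbit's generator), hence `c′ = c` (§3); so `ρ = O ⊠ χ₁ = {σ}`.
[cite: Rogawski1990, §11.1 p. 161; §12.1 pp. 171–172; §13.1 Prop. 13.1.4 p. 199] [cite: Dieudonne1971GroupesClassiques, Chap. II §5] -/
theorem eq_singleton_of_mem_of_isOneDimH
    (ρ : Finset (IrrClass ((cmDatum L 2 (Matrix.of fun i j : Fin 2 => if i.val + j.val + 1 = 2 then (1 : L) else 0)).Local v ×
      (cmDatum L 1 (Matrix.of fun i j : Fin 1 => if i.val + j.val + 1 = 1 then (1 : L) else 0)).Local v)))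
    (hρ : ∃ (O : Finset (IrrClass ((cmDatum L 2 (Matrix.of fun i j : Fin 2 => if i.val + j.val + 1 = 2 then (1 : L) else 0)).Local v)))
        (χ : (cmDatum L 1 (Matrix.of fun i j : Fin 1 => if i.val + j.val + 1 = 1 then (1 : L) else 0)).Local v →* ℂˣ)
        (hχ : IsOpen ((χ.ker : Subgroup ((cmDatum L 1 (Matrix.of fun i j : Fin 1 => if i.val + j.val + 1 = 1 then (1 : L) else 0)).Local v)) :
          Set ((cmDatum L 1 (Matrix.of fun i j : Fin 1 => if i.val + j.val + 1 = 1 then (1 : L) else 0)).Local v))),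
        (∃ σ : IrrClass ((cmDatum L 2 (Matrix.of fun i j : Fin 2 => if i.val + j.val + 1 = 2 then (1 : L) else 0)).Local v),
          σ.IsAdmissible ∧ ∀ c, c ∈ O ↔
            ∃ (T : GL (Fin 2) (LocalRing L v)) (a : LocalRing L v) (ha : IsUnit a)
              (h : formCongr (conjLocal L (IsCMField.complexConj L) v) T
                  ((Matrix.of fun i j : Fin 2 => if i.val + j.val + 1 = 2 then (1 : L) else 0).map (algebraMap L (LocalRing L v))) =
                a • (Matrix.of fun i j : Fin 2 => if i.val + j.val + 1 = 2 then (1 : L) else 0).map (algebraMap L (LocalRing L v))),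
              c = IrrClass.comap (cmDatumLocalCongr L v T ha h) σ) ∧
        ρ = O.map ⟨IrrClass.boxChar χ hχ, IrrClass.boxChar_injective χ hχ⟩)
    {σ : IrrClass ((cmDatum L 2 (Matrix.of fun i j : Fin 2 => if i.val + j.val + 1 = 2 then (1 : L) else 0)).Local v ×
      (cmDatum L 1 (Matrix.of fun i j : Fin 1 => if i.val + j.val + 1 = 1 then (1 : L) else 0)).Local v)}
    (hσ : σ ∈ ρ)
    (h1 : ∃ (Ξ : (cmDatum L 2 (Matrix.of fun i j : Fin 2 => if i.val + j.val + 1 = 2 then (1 : L) else 0)).Local v ×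
        (cmDatum L 1 (Matrix.of fun i j : Fin 1 => if i.val + j.val + 1 = 1 then (1 : L) else 0)).Local v →* ℂˣ)
        (hΞ : IsOpen ((Ξ.ker : Subgroup ((cmDatum L 2 (Matrix.of fun i j : Fin 2 => if i.val + j.val + 1 = 2 then (1 : L) else 0)).Local v ×
          (cmDatum L 1 (Matrix.of fun i j : Fin 1 => if i.val + j.val + 1 = 1 then (1 : L) else 0)).Local v)) :
          Set ((cmDatum L 2 (Matrix.of fun i j : Fin 2 => if i.val + j.val + 1 = 2 then (1 : L) else 0)).Local v ×
            (cmDatum L 1 (Matrix.of fun i j : Fin 1 => if i.val + j.val + 1 = 1 then (1 : L) else 0)).Local v))),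
        σ = IrrClass.mk (SmoothIrrep.ofChar Ξ hΞ)) :
    ρ = {σ} := by
  obtain ⟨O, χ, hχ, ⟨σ₀, -, hO⟩, rfl⟩ := hρ
  obtain ⟨Ξ, hΞ, rfl⟩ := h1
  -- the member `⟦ℂ_Ξ⟧` is `c ⊠ χ` with `c ∈ O`, and `c` is the character class `⟦ℂ_{Ξ ∘ inl}⟧`
  obtain ⟨c, hcO, hc⟩ := Finset.mem_map.1 hσ
  have hc1 : c = IrrClass.mk (SmoothIrrep.ofChar (Ξ.comp (MonoidHom.inl _ _)) (IrrClass.isOpen_ker_comp_inl hΞ)) :=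
    (IrrClass.eq_of_boxChar_eq_mk_ofChar hχ hΞ hc).1
  -- every member of the orbit `O` equals `c`
  have hOc : ∀ c' ∈ O, c' = c := by
    intro c' hc'
    have hrel := Summit.HodgeConjecture.HodgeConjecture.R90.S4.u2SimilConj_trans L v
      (Summit.HodgeConjecture.HodgeConjecture.R90.S4.u2SimilConj_symm L v ((hO c).1 hcO)) ((hO c').1 hc')
    rw [hc1] at hrel ⊢
    exact eq_of_u2SimilConj_mk_ofChar L v _ _ hrel
  -- hence `ρ = O ⊠ χ = {σ}`
  refine Finset.eq_singleton_iff_unique_mem.2 ⟨hσ, fun τ hτ => ?_⟩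
  obtain ⟨c', hc'O, rfl⟩ := Finset.mem_map.1 hτ
  rw [hOc c' hc'O]
  exact hc

/-- **(T1-homogeneity, the dealer's shape) if SOME member of a Rogawski `H_v`-packet is one-dimensional, EVERY member is** (S4-B's `IsRogPacketH` ∕
`IsOneDimH`, unfolded byte for byte): immediate from the sharp form — the packet is the singleton of that member.  This is what lets the complement type T5
of RULING S3-R3 exclude every packet meeting a character, in agreement with print's per-packet «`dim ρ = 1`».
[cite: Rogawski1990, §11.1 p. 161; §12.1 pp. 171–172; §13.1 Thm. 13.1.1 (2) p. 198, Prop. 13.1.4 p. 199] -/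
theorem isOneDimH_of_mem_of_exists
    (ρ : Finset (IrrClass ((cmDatum L 2 (Matrix.of fun i j : Fin 2 => if i.val + j.val + 1 = 2 then (1 : L) else 0)).Local v ×
      (cmDatum L 1 (Matrix.of fun i j : Fin 1 => if i.val + j.val + 1 = 1 then (1 : L) else 0)).Local v)))
    (hρ : ∃ (O : Finset (IrrClass ((cmDatum L 2 (Matrix.of fun i j : Fin 2 => if i.val + j.val + 1 = 2 then (1 : L) else 0)).Local v)))
        (χ : (cmDatum L 1 (Matrix.of fun i j : Fin 1 => if i.val + j.val + 1 = 1 then (1 : L) else 0)).Local v →* ℂˣ)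
        (hχ : IsOpen ((χ.ker : Subgroup ((cmDatum L 1 (Matrix.of fun i j : Fin 1 => if i.val + j.val + 1 = 1 then (1 : L) else 0)).Local v)) :
          Set ((cmDatum L 1 (Matrix.of fun i j : Fin 1 => if i.val + j.val + 1 = 1 then (1 : L) else 0)).Local v))),
        (∃ σ : IrrClass ((cmDatum L 2 (Matrix.of fun i j : Fin 2 => if i.val + j.val + 1 = 2 then (1 : L) else 0)).Local v),
          σ.IsAdmissible ∧ ∀ c, c ∈ O ↔
            ∃ (T : GL (Fin 2) (LocalRing L v)) (a : LocalRing L v) (ha : IsUnit a)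
              (h : formCongr (conjLocal L (IsCMField.complexConj L) v) T
                  ((Matrix.of fun i j : Fin 2 => if i.val + j.val + 1 = 2 then (1 : L) else 0).map (algebraMap L (LocalRing L v))) =
                a • (Matrix.of fun i j : Fin 2 => if i.val + j.val + 1 = 2 then (1 : L) else 0).map (algebraMap L (LocalRing L v))),
              c = IrrClass.comap (cmDatumLocalCongr L v T ha h) σ) ∧
        ρ = O.map ⟨IrrClass.boxChar χ hχ, IrrClass.boxChar_injective χ hχ⟩)
    (hex : ∃ σ ∈ ρ, ∃ (Ξ : (cmDatum L 2 (Matrix.of fun i j : Fin 2 => if i.val + j.val + 1 = 2 then (1 : L) else 0)).Local v ×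
        (cmDatum L 1 (Matrix.of fun i j : Fin 1 => if i.val + j.val + 1 = 1 then (1 : L) else 0)).Local v →* ℂˣ)
        (hΞ : IsOpen ((Ξ.ker : Subgroup ((cmDatum L 2 (Matrix.of fun i j : Fin 2 => if i.val + j.val + 1 = 2 then (1 : L) else 0)).Local v ×
          (cmDatum L 1 (Matrix.of fun i j : Fin 1 => if i.val + j.val + 1 = 1 then (1 : L) else 0)).Local v)) :
          Set ((cmDatum L 2 (Matrix.of fun i j : Fin 2 => if i.val + j.val + 1 = 2 then (1 : L) else 0)).Local v ×
            (cmDatum L 1 (Matrix.of fun i j : Fin 1 => if i.val + j.val + 1 = 1 then (1 : L) else 0)).Local v))),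
        σ = IrrClass.mk (SmoothIrrep.ofChar Ξ hΞ)) :
    ∀ σ ∈ ρ, ∃ (Ξ : (cmDatum L 2 (Matrix.of fun i j : Fin 2 => if i.val + j.val + 1 = 2 then (1 : L) else 0)).Local v ×
        (cmDatum L 1 (Matrix.of fun i j : Fin 1 => if i.val + j.val + 1 = 1 then (1 : L) else 0)).Local v →* ℂˣ)
        (hΞ : IsOpen ((Ξ.ker : Subgroup ((cmDatum L 2 (Matrix.of fun i j : Fin 2 => if i.val + j.val + 1 = 2 then (1 : L) else 0)).Local v ×
          (cmDatum L 1 (Matrix.of fun i j : Fin 1 => if i.val + j.val + 1 = 1 then (1 : L) else 0)).Local v)) :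
          Set ((cmDatum L 2 (Matrix.of fun i j : Fin 2 => if i.val + j.val + 1 = 2 then (1 : L) else 0)).Local v ×
            (cmDatum L 1 (Matrix.of fun i j : Fin 1 => if i.val + j.val + 1 = 1 then (1 : L) else 0)).Local v))),
        σ = IrrClass.mk (SmoothIrrep.ofChar Ξ hΞ) := by
  obtain ⟨σ, hσ, h1⟩ := hex
  have hρσ := eq_singleton_of_mem_of_isOneDimH L v ρ hρ hσ h1
  intro τ hτ
  rw [hρσ, Finset.mem_singleton] at hτ
  rw [hτ]
  exact h1

end CM

end Summit.HodgeConjecture.HodgeConjecture.R90.S3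

end
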